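import Mathlib
import HarnessLib

/-!
# Route `KLProgramme` — crux C4a, S3 brick (B4) «(U1)-HYBRID», «SWAP-BY-SYMMETRY» part 3: the partner's level bump ABSORBED INTO THE KERNEL FAMILY —
# U7's kernel rows and B-1 (vi)'s six rows transfer from `Kr` to `(e,u) ↦ χ(u)·Kr(e,u)/C` by the product rule

Cell `gate-hubbard-kl`, seat hubbard-kl-k3c3-p3 (g38; row «implicit-function / monotonicity route for μ(n)»).  Located brick for the (C)-closer lane / the kernel side
(k3c3-p1's FarS/MidS one-calls over `…C4aUmkLoopCircleCanonical[Middle]` and `…C4aFirstOrderLayerSum`), memo HOME/hubbard-kl-k3c3-p3/SWAP-BY-SYMMETRY.md.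
In the symmetric organisation (`…C4aBubbleSwapSymmetry`: `𝐁[χ⊗χ·P] = 2𝐁[χ⊗χ·A_s] + 𝐁[χ⊗χ·M_s]`) the loop keeps its bump as the level weight `wt = χ` and the
PARTNER's copy multiplies the kernel: the families the laws read are `u ↦ χ(u)·A_s(e,u)`, `u ↦ χ(u)·M_s(e,u)`.  This file is kernel-agnostic: for any family `Kr`
meeting U7's normalised rows and any `C²` bump `χ` (`|χ| ≤ 1`, `|χ′| ≤ B₁`, `|χ″| ≤ B₂`, `χ′ = χ″ = 0` off `|u| < R`, `lo ≤ hi ≤ R`), the family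
`Kχ e u := χ(u)·Kr(e,u)/C` with `1 + 2B₁R + B₂R² ≤ C` meets them again:
* §1 calculus: `deriv_bumpKernel`, `iteratedDeriv_two_bumpKernel`, `inv_le_mul_inv_sq` (`m ≤ R ⟹ m⁻¹ ≤ R·m⁻²`);
* §2 the envelope / regularity / support rows **`bumpKernel_hKd`**, **`_hK2d`**, **`_hK0`**, **`_hK0s`**, **`_hK1`**, **`_hKs1`**, **`_hK2`**, **`_hsupp`** (from the VALUE
  vanishing `Kr e u = 0` on `|u| ≤ q_s·e` — true for `A_s`, `ppFarKernelS_eq_zero_of_abs_le`), **`_hKc`**;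
* the two rows that see the weight (`hflat` at the modified weight `wt·χ(D − ·)`, `hKn1` with a value majorant on the bump's transition zone, and the `ρ` rows) are
  the companion `…C4aKernelBumpRowsWeighted`.
So the closer / kernel side obtains the thirteen rows of `foldBox_law_rows'` (and a fortiori the six of `firstOrderLayer_abs_le`) for `χ·A_s/C̃`, `χ·M_s/C̃` from the
landed bundles plus one thermal value lemma at opposite-sign levels (for `ρv`).
Pure one-variable calculus; nothing about the model; nothing asserts (C), K3, the window or superconductivity.
References: BGM 2006 §2.4 (2.36) [cite: BenfattoGiulianiMastropietro2006]; FST II CPAM 51 (1998) §3 [cite: FeldmanSalmhoferTrubowitz1998].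
-/

noncomputable section

namespace Summit.HubbardSuperconductivity.HubbardSuperconductivity.Theorems.C4a

set_option linter.dupNamespace false -- summit = problem name (single-conjunct summit), D-0017

open Real Set Filter MeasureTheory intervalIntegral
open scoped Topology Interval

/-! ## §1 Calculus of the bumped family -/

section Calculus

/-- `0 < m ≤ R ⟹ m⁻¹ ≤ R·(m⁻¹)²`. -/
theorem inv_le_mul_inv_sq {m R : ℝ} (hm : 0 < m) (hmR : m ≤ R) : m⁻¹ ≤ R * m⁻¹ ^ 2 := by
  rw [pow_two, ← mul_assoc]
  have : 1 ≤ R * m⁻¹ := by rw [le_mul_inv_iff₀ hm, one_mul]; exact hmR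
  calc m⁻¹ = 1 * m⁻¹ := (one_mul _).symm
    _ ≤ R * m⁻¹ * m⁻¹ := mul_le_mul_of_nonneg_right this (inv_nonneg.2 hm.le)

/-- `0 < m ≤ R ⟹ (m⁻¹)² ≤ R·(m⁻¹)³` and `m⁻¹ ≤ R²·(m⁻¹)³`. -/
theorem inv_sq_le_mul_inv_cube {m R : ℝ} (hm : 0 < m) (hmR : m ≤ R) : m⁻¹ ^ 2 ≤ R * m⁻¹ ^ 3 ∧ m⁻¹ ≤ R ^ 2 * m⁻¹ ^ 3 := by
  have h1 := inv_le_mul_inv_sq hm hmR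
  have hi0 : 0 ≤ m⁻¹ := inv_nonneg.2 hm.le
  have hR0 : 0 ≤ R := hm.le.trans hmR
  have h2 : m⁻¹ ^ 2 ≤ R * m⁻¹ ^ 3 := by
    calc m⁻¹ ^ 2 = m⁻¹ * m⁻¹ := pow_two _
      _ ≤ (R * m⁻¹ ^ 2) * m⁻¹ := mul_le_mul_of_nonneg_right h1 hi0
      _ = R * m⁻¹ ^ 3 := by ring
  refine ⟨h2, ?_⟩
  calc m⁻¹ ≤ R * m⁻¹ ^ 2 := h1
    _ ≤ R * (R * m⁻¹ ^ 3) := mul_le_mul_of_nonneg_left h2 hR0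
    _ = R ^ 2 * m⁻¹ ^ 3 := by ring

variable {χ : ℝ → ℝ} {K : ℝ → ℝ} {C : ℝ}

/-- Product rule for the bumped kernel: `(χ·K/C)′ = (χ′K + χK′)/C`. -/
theorem deriv_bumpKernel (hχ : Differentiable ℝ χ) (hK : Differentiable ℝ K) (u : ℝ) :
    deriv (fun v => χ v * K v / C) u = (deriv χ u * K u + χ u * deriv K u) / C := by
  rw [deriv_div_const, deriv_fun_mul (hχ u) (hK u)]

/-- The derivative function of the bumped kernel. -/
theorem deriv_bumpKernel_fun (hχ : Differentiable ℝ χ) (hK : Differentiable ℝ K) :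
    deriv (fun v => χ v * K v / C) = fun u => (deriv χ u * K u + χ u * deriv K u) / C :=
  funext fun u => deriv_bumpKernel hχ hK u

/-- Second derivative of the bumped kernel: `(χ·K/C)″ = (χ″K + 2χ′K′ + χK″)/C` for `C²` factors. -/
theorem iteratedDeriv_two_bumpKernel (hχ : ContDiff ℝ 2 χ) (hK : ContDiff ℝ 2 K) (u : ℝ) :
    iteratedDeriv 2 (fun v => χ v * K v / C) u =
      (deriv (deriv χ) u * K u + 2 * (deriv χ u * deriv K u) + χ u * iteratedDeriv 2 K u) / C := by
  have hχ1 : Differentiable ℝ χ := hχ.differentiable (by norm_num)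
  have hK1 : Differentiable ℝ K := hK.differentiable (by norm_num)
  have hχ2 : Differentiable ℝ (deriv χ) := by
    simpa only [iteratedDeriv_one] using hχ.differentiable_iteratedDeriv 1 (by norm_num)
  have hK2 : Differentiable ℝ (deriv K) := by
    simpa only [iteratedDeriv_one] using hK.differentiable_iteratedDeriv 1 (by norm_num)
  have hd1 : DifferentiableAt ℝ (fun y => deriv χ y * K y) u := (hχ2 u).mul (hK1 u)
  have hd2 : DifferentiableAt ℝ (fun y => χ y * deriv K y) u := (hχ1 u).mul (hK2 u)
  rw [iteratedDeriv_succ, iteratedDeriv_one, iteratedDeriv_succ, iteratedDeriv_one, deriv_bumpKernel_fun hχ1 hK1, deriv_div_const,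
    deriv_fun_add hd1 hd2, deriv_fun_mul (hχ2 u) (hK1 u), deriv_fun_mul (hχ1 u) (hK2 u)]
  ring

/-- `ContDiff` of the bumped kernel. -/
theorem contDiff_bumpKernel {n : ℕ∞} (hχ : ContDiff ℝ n χ) (hK : ContDiff ℝ n K) : ContDiff ℝ n fun v => χ v * K v / C :=
  (hχ.mul hK).div_const C

end Calculus

/-! ## §2 The envelope, regularity and support rows -/

section Rows

variable {χ : ℝ → ℝ} (hχ : ContDiff ℝ 2 χ) {Bχ₁ Bχ₂ Rχ : ℝ} (hχ0 : ∀ u, |χ u| ≤ 1) (hχ1 : ∀ u, |deriv χ u| ≤ Bχ₁)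
  (hχ2 : ∀ u, |deriv (deriv χ) u| ≤ Bχ₂) (hχ1z : ∀ u, Rχ ≤ |u| → deriv χ u = 0) (hχ2z : ∀ u, Rχ ≤ |u| → deriv (deriv χ) u = 0)
  {Kr : ℝ → ℝ → ℝ} {lo hi C : ℝ} (hlo : 0 < lo) (hlohi : lo ≤ hi) (hhiR : hi ≤ Rχ) (hC : 1 + 2 * Bχ₁ * Rχ + Bχ₂ * Rχ ^ 2 ≤ C)

include hχ1 in
/-- A bound on `|χ′|` is nonnegative. -/
theorem bumpB₁_nonneg : 0 ≤ Bχ₁ := (abs_nonneg _).trans (hχ1 0)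

include hχ2 in
/-- A bound on `|χ″|` is nonnegative. -/
theorem bumpB₂_nonneg : 0 ≤ Bχ₂ := (abs_nonneg _).trans (hχ2 0)

include hχ1 hχ2 hlo hlohi hhiR hC in
/-- The normalisation `C ≥ 1 + 2B₁R + B₂R²` is at least `1`. -/
theorem bumpNormalisation_one_le : 1 ≤ C := by
  have h1 := bumpB₁_nonneg hχ1
  have h2 := bumpB₂_nonneg hχ2
  have hR : 0 ≤ Rχ := (hlo.le.trans hlohi).trans hhiR
  nlinarith [mul_nonneg h1 hR, mul_nonneg h2 (sq_nonneg Rχ)]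

include hχ in
/-- **Row `hKd`** (`C¹` in the partner level) transfers. -/
theorem bumpKernel_hKd (hKd : ∀ e ∈ Icc (-hi) hi, ContDiff ℝ 1 (Kr e)) :
    ∀ e ∈ Icc (-hi) hi, ContDiff ℝ 1 (fun u => χ u * Kr e u / C) := fun e he =>
  contDiff_bumpKernel (hχ.of_le (by norm_num)) (hKd e he)

include hχ in
/-- **Row `hK2d`** (`C²` at positive loop levels) transfers. -/
theorem bumpKernel_hK2d (hK2d : ∀ e ∈ Icc lo hi, ContDiff ℝ 2 (Kr e)) :
    ∀ e ∈ Icc lo hi, ContDiff ℝ 2 (fun u => χ u * Kr e u / C) := fun e he =>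
  contDiff_bumpKernel hχ (hK2d e he)

include hχ0 hχ1 hχ2 hlo hlohi hhiR hC in
/-- **Row `hK0`** (value envelope off the strip) transfers: `|χK/C| ≤ |K|`. -/
theorem bumpKernel_hK0 (hK0 : ∀ e ∈ Icc (-hi) hi, e ≠ 0 → ∀ u, |Kr e u| ≤ (max |e| |u|)⁻¹) :
    ∀ e ∈ Icc (-hi) hi, e ≠ 0 → ∀ u, |χ u * Kr e u / C| ≤ (max |e| |u|)⁻¹ := fun e he hne u => by
  have hC1 := bumpNormalisation_one_le hχ1 hχ2 hlo hlohi hhiR hC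
  rw [abs_div, abs_mul, abs_of_pos (by linarith : (0 : ℝ) < C)]
  have h1 : |χ u| * |Kr e u| ≤ 1 * (max |e| |u|)⁻¹ := mul_le_mul (hχ0 u) (hK0 e he hne u) (abs_nonneg _) zero_le_one
  rw [one_mul] at h1
  exact (div_le_self (by positivity) hC1).trans h1

include hχ0 hχ1 hχ2 hlo hlohi hhiR hC in
/-- **Row `hK0s`** (value envelope on the strip) transfers. -/
theorem bumpKernel_hK0s (hK0s : ∀ e ∈ Icc (-lo) lo, ∀ u, |Kr e u| ≤ (max lo |u|)⁻¹) :
    ∀ e ∈ Icc (-lo) lo, ∀ u, |χ u * Kr e u / C| ≤ (max lo |u|)⁻¹ := fun e he u => by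
  have hC1 := bumpNormalisation_one_le hχ1 hχ2 hlo hlohi hhiR hC
  rw [abs_div, abs_mul, abs_of_pos (by linarith : (0 : ℝ) < C)]
  have h1 : |χ u| * |Kr e u| ≤ 1 * (max lo |u|)⁻¹ := mul_le_mul (hχ0 u) (hK0s e he u) (abs_nonneg _) zero_le_one
  rw [one_mul] at h1
  exact (div_le_self (by positivity) hC1).trans h1

include hχ hχ0 hχ1 hχ2 hχ1z hlo hlohi hhiR hC in
/-- **Row `hK1`** (derivative envelope off the strip) transfers: `|(χK)′| ≤ B₁R·max⁻² + max⁻²` on the bump's zone (`max(|e|,|u|) ≤ R` there), `/C`. -/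
theorem bumpKernel_hK1 (hKd : ∀ e ∈ Icc (-hi) hi, ContDiff ℝ 1 (Kr e)) (hK0 : ∀ e ∈ Icc (-hi) hi, e ≠ 0 → ∀ u, |Kr e u| ≤ (max |e| |u|)⁻¹)
    (hK1 : ∀ e ∈ Icc (-hi) hi, e ≠ 0 → ∀ u, |deriv (Kr e) u| ≤ (max |e| |u|)⁻¹ ^ 2) :
    ∀ e ∈ Icc (-hi) hi, e ≠ 0 → ∀ u, |deriv (fun v => χ v * Kr e v / C) u| ≤ (max |e| |u|)⁻¹ ^ 2 := fun e he hne u => by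
  have hC1 := bumpNormalisation_one_le hχ1 hχ2 hlo hlohi hhiR hC
  have hB1 := bumpB₁_nonneg hχ1
  have hB2 := bumpB₂_nonneg hχ2
  have hR : 0 ≤ Rχ := (hlo.le.trans hlohi).trans hhiR
  have hm : 0 < max |e| |u| := lt_max_of_lt_left (abs_pos.2 hne)
  rw [deriv_bumpKernel (hχ.differentiable (by norm_num)) ((hKd e he).differentiable one_ne_zero), abs_div, abs_of_pos (by linarith : (0 : ℝ) < C),
    div_le_iff₀ (by linarith : (0 : ℝ) < C)]
  -- the `χ′K` term
  have hA : |deriv χ u * Kr e u| ≤ Bχ₁ * Rχ * (max |e| |u|)⁻¹ ^ 2 := by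
    by_cases hu : Rχ ≤ |u|
    · rw [hχ1z u hu, zero_mul, abs_zero]; positivity
    · push Not at hu
      have hmR : max |e| |u| ≤ Rχ := max_le ((abs_le.2 ⟨by linarith [he.1], by linarith [he.2]⟩).trans hhiR) hu.le
      rw [abs_mul]
      calc |deriv χ u| * |Kr e u| ≤ Bχ₁ * (max |e| |u|)⁻¹ := mul_le_mul (hχ1 u) (hK0 e he hne u) (abs_nonneg _) hB1
        _ ≤ Bχ₁ * (Rχ * (max |e| |u|)⁻¹ ^ 2) := mul_le_mul_of_nonneg_left (inv_le_mul_inv_sq hm hmR) hB1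
        _ = _ := by ring
  have hB : |χ u * deriv (Kr e) u| ≤ 1 * (max |e| |u|)⁻¹ ^ 2 := by
    rw [abs_mul]; exact mul_le_mul (hχ0 u) (hK1 e he hne u) (abs_nonneg _) zero_le_one
  have hpos : 0 ≤ (max |e| |u|)⁻¹ ^ 2 := by positivity
  calc |deriv χ u * Kr e u + χ u * deriv (Kr e) u| ≤ Bχ₁ * Rχ * (max |e| |u|)⁻¹ ^ 2 + 1 * (max |e| |u|)⁻¹ ^ 2 := (abs_add_le _ _).trans (add_le_add hA hB)
    _ = (1 + Bχ₁ * Rχ) * (max |e| |u|)⁻¹ ^ 2 := by ring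
    _ ≤ C * (max |e| |u|)⁻¹ ^ 2 := by gcongr; nlinarith [mul_nonneg hB1 hR, mul_nonneg hB2 (sq_nonneg Rχ)]
    _ = _ := by ring

include hχ hχ0 hχ1 hχ2 hχ1z hlo hlohi hhiR hC in
/-- **Row `hKs1`** (derivative envelope on the strip) transfers (`lo ≤ R`). -/
theorem bumpKernel_hKs1 (hKd : ∀ e ∈ Icc (-hi) hi, ContDiff ℝ 1 (Kr e)) (hK0s : ∀ e ∈ Icc (-lo) lo, ∀ u, |Kr e u| ≤ (max lo |u|)⁻¹)
    (hKs1 : ∀ e ∈ Icc (-lo) lo, ∀ u, |deriv (Kr e) u| ≤ (max lo |u|)⁻¹ ^ 2) :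
    ∀ e ∈ Icc (-lo) lo, ∀ u, |deriv (fun v => χ v * Kr e v / C) u| ≤ (max lo |u|)⁻¹ ^ 2 := fun e he u => by
  have hC1 := bumpNormalisation_one_le hχ1 hχ2 hlo hlohi hhiR hC
  have hB1 := bumpB₁_nonneg hχ1
  have hB2 := bumpB₂_nonneg hχ2
  have hR : 0 ≤ Rχ := (hlo.le.trans hlohi).trans hhiR
  have hm : 0 < max lo |u| := lt_max_of_lt_left hlo
  have he' : e ∈ Icc (-hi) hi := ⟨by linarith [he.1], by linarith [he.2]⟩
  rw [deriv_bumpKernel (hχ.differentiable (by norm_num)) ((hKd e he').differentiable one_ne_zero), abs_div, abs_of_pos (by linarith : (0 : ℝ) < C),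
    div_le_iff₀ (by linarith : (0 : ℝ) < C)]
  have hA : |deriv χ u * Kr e u| ≤ Bχ₁ * Rχ * (max lo |u|)⁻¹ ^ 2 := by
    by_cases hu : Rχ ≤ |u|
    · rw [hχ1z u hu, zero_mul, abs_zero]; positivity
    · push Not at hu
      have hmR : max lo |u| ≤ Rχ := max_le (hlohi.trans hhiR) hu.le
      rw [abs_mul]
      calc |deriv χ u| * |Kr e u| ≤ Bχ₁ * (max lo |u|)⁻¹ := mul_le_mul (hχ1 u) (hK0s e he u) (abs_nonneg _) hB1
        _ ≤ Bχ₁ * (Rχ * (max lo |u|)⁻¹ ^ 2) := mul_le_mul_of_nonneg_left (inv_le_mul_inv_sq hm hmR) hB1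
        _ = _ := by ring
  have hB : |χ u * deriv (Kr e) u| ≤ 1 * (max lo |u|)⁻¹ ^ 2 := by
    rw [abs_mul]; exact mul_le_mul (hχ0 u) (hKs1 e he u) (abs_nonneg _) zero_le_one
  have hpos : 0 ≤ (max lo |u|)⁻¹ ^ 2 := by positivity
  calc |deriv χ u * Kr e u + χ u * deriv (Kr e) u| ≤ Bχ₁ * Rχ * (max lo |u|)⁻¹ ^ 2 + 1 * (max lo |u|)⁻¹ ^ 2 := (abs_add_le _ _).trans (add_le_add hA hB)
    _ = (1 + Bχ₁ * Rχ) * (max lo |u|)⁻¹ ^ 2 := by ring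
    _ ≤ C * (max lo |u|)⁻¹ ^ 2 := by gcongr; nlinarith [mul_nonneg hB1 hR, mul_nonneg hB2 (sq_nonneg Rχ)]
    _ = _ := by ring

include hχ hχ0 hχ1 hχ2 hχ1z hχ2z hlo hlohi hhiR hC in
/-- **Row `hK2`** (second-derivative envelope at positive loop levels) transfers: `|(χK)″| ≤ (B₂R² + 2B₁R + 1)·max⁻³`, `/C`. -/
theorem bumpKernel_hK2 (hK2d : ∀ e ∈ Icc lo hi, ContDiff ℝ 2 (Kr e)) (hK0 : ∀ e ∈ Icc (-hi) hi, e ≠ 0 → ∀ u, |Kr e u| ≤ (max |e| |u|)⁻¹)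
    (hK1 : ∀ e ∈ Icc (-hi) hi, e ≠ 0 → ∀ u, |deriv (Kr e) u| ≤ (max |e| |u|)⁻¹ ^ 2)
    (hK2 : ∀ e ∈ Icc lo hi, ∀ u, |iteratedDeriv 2 (Kr e) u| ≤ (max e |u|)⁻¹ ^ 3) :
    ∀ e ∈ Icc lo hi, ∀ u, |iteratedDeriv 2 (fun v => χ v * Kr e v / C) u| ≤ (max e |u|)⁻¹ ^ 3 := fun e he u => by
  have hC1 := bumpNormalisation_one_le hχ1 hχ2 hlo hlohi hhiR hC
  have hB1 := bumpB₁_nonneg hχ1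
  have hB2 := bumpB₂_nonneg hχ2
  have hR : 0 ≤ Rχ := (hlo.le.trans hlohi).trans hhiR
  have he0 : 0 < e := hlo.trans_le he.1
  have he' : e ∈ Icc (-hi) hi := ⟨by linarith [he.1, he.2], he.2⟩
  have hea : |e| = e := abs_of_pos he0
  have hm : 0 < max e |u| := lt_max_of_lt_left he0
  rw [iteratedDeriv_two_bumpKernel hχ (hK2d e he), abs_div, abs_of_pos (by linarith : (0 : ℝ) < C), div_le_iff₀ (by linarith : (0 : ℝ) < C)]
  have hK0' : |Kr e u| ≤ (max e |u|)⁻¹ := by have := hK0 e he' he0.ne' u; rwa [hea] at this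
  have hK1' : |deriv (Kr e) u| ≤ (max e |u|)⁻¹ ^ 2 := by have := hK1 e he' he0.ne' u; rwa [hea] at this
  -- the three terms
  have hA : |deriv (deriv χ) u * Kr e u| ≤ Bχ₂ * Rχ ^ 2 * (max e |u|)⁻¹ ^ 3 := by
    by_cases hu : Rχ ≤ |u|
    · rw [hχ2z u hu, zero_mul, abs_zero]; positivity
    · push Not at hu
      have hmR : max e |u| ≤ Rχ := max_le (he.2.trans hhiR) hu.le
      rw [abs_mul]
      calc |deriv (deriv χ) u| * |Kr e u| ≤ Bχ₂ * (max e |u|)⁻¹ := mul_le_mul (hχ2 u) hK0' (abs_nonneg _) hB2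
        _ ≤ Bχ₂ * (Rχ ^ 2 * (max e |u|)⁻¹ ^ 3) := mul_le_mul_of_nonneg_left (inv_sq_le_mul_inv_cube hm hmR).2 hB2
        _ = _ := by ring
  have hB : |2 * (deriv χ u * deriv (Kr e) u)| ≤ 2 * (Bχ₁ * Rχ) * (max e |u|)⁻¹ ^ 3 := by
    by_cases hu : Rχ ≤ |u|
    · rw [hχ1z u hu, zero_mul, mul_zero, abs_zero]; positivity
    · push Not at hu
      have hmR : max e |u| ≤ Rχ := max_le (he.2.trans hhiR) hu.le
      rw [abs_mul, abs_two, abs_mul]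
      calc 2 * (|deriv χ u| * |deriv (Kr e) u|) ≤ 2 * (Bχ₁ * (max e |u|)⁻¹ ^ 2) :=
            mul_le_mul_of_nonneg_left (mul_le_mul (hχ1 u) hK1' (abs_nonneg _) hB1) zero_le_two
        _ ≤ 2 * (Bχ₁ * (Rχ * (max e |u|)⁻¹ ^ 3)) :=
            mul_le_mul_of_nonneg_left (mul_le_mul_of_nonneg_left (inv_sq_le_mul_inv_cube hm hmR).1 hB1) zero_le_two
        _ = _ := by ring
  have hCc : |χ u * iteratedDeriv 2 (Kr e) u| ≤ 1 * (max e |u|)⁻¹ ^ 3 := by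
    rw [abs_mul]; exact mul_le_mul (hχ0 u) (hK2 e he u) (abs_nonneg _) zero_le_one
  have hpos : 0 ≤ (max e |u|)⁻¹ ^ 3 := by positivity
  calc |deriv (deriv χ) u * Kr e u + 2 * (deriv χ u * deriv (Kr e) u) + χ u * iteratedDeriv 2 (Kr e) u|
      ≤ Bχ₂ * Rχ ^ 2 * (max e |u|)⁻¹ ^ 3 + 2 * (Bχ₁ * Rχ) * (max e |u|)⁻¹ ^ 3 + 1 * (max e |u|)⁻¹ ^ 3 :=
        (abs_add_three _ _ _).trans (add_le_add (add_le_add hA hB) hCc)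
    _ = (1 + 2 * Bχ₁ * Rχ + Bχ₂ * Rχ ^ 2) * (max e |u|)⁻¹ ^ 3 := by ring
    _ ≤ C * (max e |u|)⁻¹ ^ 3 := by gcongr
    _ = _ := by ring

include hχ in
/-- **Row `hsupp`** transfers from the VALUE vanishing of `Kr` on the support zone (`Kr e u = 0` and `(Kr e)′ u = 0` for `|u| ≤ q_s·e`). -/
theorem bumpKernel_hsupp {qs : ℝ} (hKd : ∀ e ∈ Icc (-hi) hi, ContDiff ℝ 1 (Kr e))
    (hsupp0 : ∀ e ∈ Icc lo hi, ∀ u, |u| ≤ qs * e → Kr e u = 0) (hsupp : ∀ e ∈ Icc lo hi, ∀ u, |u| ≤ qs * e → deriv (Kr e) u = 0)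
    (hlo : 0 < lo) :
    ∀ e ∈ Icc lo hi, ∀ u, |u| ≤ qs * e → deriv (fun v => χ v * Kr e v / C) u = 0 := fun e he u hu => by
  have he' : e ∈ Icc (-hi) hi := ⟨by linarith [he.1, he.2], he.2⟩
  rw [deriv_bumpKernel (hχ.differentiable (by norm_num)) ((hKd e he').differentiable one_ne_zero), hsupp0 e he u hu, hsupp e he u hu]
  simp

include hχ in
/-- **Row `hKc`** (joint continuity of the partner derivative) transfers, given joint continuity of `Kr` itself. -/
theorem bumpKernel_hKc (hKdiff : ∀ e, Differentiable ℝ (Kr e)) (hKc0 : Continuous fun p : ℝ × ℝ => Kr p.1 p.2)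
    (hKc : Continuous fun p : ℝ × ℝ => deriv (Kr p.1) p.2) :
    Continuous fun p : ℝ × ℝ => deriv (fun v => χ v * Kr p.1 v / C) p.2 := by
  have hχ1 : Differentiable ℝ χ := hχ.differentiable (by norm_num)
  have h : (fun p : ℝ × ℝ => deriv (fun v => χ v * Kr p.1 v / C) p.2) =
      fun p : ℝ × ℝ => (deriv χ p.2 * Kr p.1 p.2 + χ p.2 * deriv (Kr p.1) p.2) / C := by
    funext p; exact deriv_bumpKernel hχ1 (hKdiff p.1) p.2
  rw [h]
  have hcχ' : Continuous (deriv χ) := (hχ.continuous_deriv (by norm_num))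
  exact (((hcχ'.comp continuous_snd).mul hKc0).add ((hχ.continuous.comp continuous_snd).mul hKc)).div_const C

end Rows

end Summit.HubbardSuperconductivity.HubbardSuperconductivity.Theorems.C4a

end
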